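import Mathlib
import HarnessLib
import Summits.Ventures.LatticeQCDFlow.Exactness.SpherePlaneRotation
import Summits.Ventures.LatticeQCDFlow.Exactness.SphereFrameLift
import Summits.Ventures.LatticeQCDFlow.Exactness.SphereGeodesicDrift

/-!
# Liouville for the geodesic drift on the sphere, by the frame lift: E–S eq. (11) with ambient momenta preserves `uniformSphere ⊗ Lebesgue`

HONEST FRAMING: exact (Metropolis-corrected) sampling algorithms for lattice gauge theory;
figures of merit are autocorrelation/cost numbers at stated couplings and volumes; no
continuum-physics claim.

Venture `LatticeQCDFlow` (cell pub-lqcd), topic `Exactness`; FANOUT row 7 (`s0-cpn-null`: the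
S0-D1 rung — 2D CP⁹ HMC and THMC with the molecular dynamics of Engel–Schaefer §2.2).  NEW WORK
of the cell over Mathlib (`MeasurePreserving.of_semiconj`, `measurePreserving_mul_right` for Haar
on a compact group) and the tree's `SpherePlaneRotation.lean` (`planeRot`: the rotation of the body
axis towards the body-frame momentum, in `SO(d)`), `SphereFrameLift.lean` (`frameMap`,
`measurePreserving_frameMap`, `skew_product_snd`, `ambientKick`, `ambientFlip`), row 7's
`SphereGeodesicDrift.lean` (`geodesicDrift`, `norm_fst_geodesicDrift`,
`geodesicDrift_flip_geodesicDrift`: E–S eq. (11) and its time reversal) and row 9's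
`SphereOrbitLaw.lean` / `CompactHaar.lean`.  Nothing is cited as a fact.  Printed counterpart,
NAMED ONLY: Engel–Schaefer, Comput. Phys. Commun. 182 (2011) 2107, §2.2 eq. (11); Liouville's
theorem for the geodesic flow (e.g. Paternain, *Geodesic Flows*, §1.3) — NOT formalised as
symplectic geometry: the proof here is a group-theoretic lift, no Jacobian is computed.

`SphereGeodesicDrift.lean` lists as NOT CLAIMED "preservation of the Liouville measure of `TS` by
the drift (hypothesis 2 of `involMH`; the geodesic flow's symplecticity)".  This file proves it in
the product form consumed by `MomentumRefresh.hmc_config_exact`: on `S^{d−1} × ℝ^d` with AMBIENT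
momenta, the drift acting on the tangential part `p − ⟪x,p⟫x` by E–S eq. (11) and carrying the
normal component `⟪x,p⟫` along unchanged preserves `uniformSphere ⊗ Lebesgue`.

## Method

`frameMap e (O, q) = (O e, O q)` pushes `Haar ⊗ Lebesgue` to `uniformSphere ⊗ Lebesgue`
(`SphereFrameLift.lean`).  The drift LIFTS along it to `driftLift t e (O, q) = (O · R_t(q), q)`,
`R_t(q) = planeRot t e (q − (e·q) e) ∈ SO(d)` (`frameMap_driftLift`, from `planeRot_mulVec_axis` /
`planeRot_mulVec_tangent`), which preserves `Haar ⊗ Lebesgue` fibre by fibre over `q` by RIGHT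
INVARIANCE OF HAAR on the compact group `SO(d)`; measure preservation descends along the factor
map (`MeasurePreserving.of_semiconj`).  Measurability of `q ↦ R_t(q)` (continuous off the axis line,
`= 1` on it) is `measurable_of_continuousOn_isOpen_of_eq`.

## Content (`m` finite, `E = EuclideanSpace ℝ m`, `S` its unit sphere, `SO = specialOrthogonalGroup m ℝ`)

* `measurable_of_continuousOn_isOpen_of_eq` (tool).
* `bodyTangent e q = q − (e·q) e` (coordinates), `bodyRot t e q ∈ SO(d)`, **`measurable_bodyRot`**,
  `rotSO_bodyRot_axis`, `rotSO_bodyRot_tangent` (the E–S pair, as Euclidean vectors).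
* `tangentialPart`, **`ambientDrift t`** (E–S eq. (11) on `S × E`, normal component carried),
  `measurable_geodesicDrift`, `measurable_ambientDrift`.
* `driftLift`, **`measurePreserving_driftLift`** (Haar right invariance), **`frameMap_driftLift`**
  (the lift identity).
* Bookkeeping: `norm_sq_eq_tangential_add_normal` (`‖p‖² = ‖π‖² + ⟪x,p⟫²`), `inner_ambientDrift`
  and `inner_ambientKick` (the normal component is carried by the drift, untouched by a tangent
  kick), `tangentialPart_ambientDrift` (the tangential momentum follows eq. (11)),
  **`ambientDrift_flip_ambientDrift`** (time reversal: drift, flip, drift = flipped start).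
* **`measurePreserving_ambientDrift`** (`card m ≥ 2`): LIOUVILLE, product form.

NOT CLAIMED: the lattice product over sites (next files, bookkeeping over this one);
identification with the Riemannian Liouville measure of `TS^{d−1}`; `card m = 1`.
-/

noncomputable section

namespace Summit.Ventures.LatticeQCDFlow.Exactness

open MeasureTheory Measure Metric Set Matrix WithLp Real
open scoped ENNReal InnerProductSpace

/-! ## The geodesic drift with ambient momenta lifts to a right translation of the frame -/

section MeasTool

variable {X Y : Type*} [TopologicalSpace X] [MeasurableSpace X] [OpensMeasurableSpace X]
  [TopologicalSpace Y] [MeasurableSpace Y] [BorelSpace Y]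

/-- A map continuous on an open set and constant off it is measurable. -/
theorem measurable_of_continuousOn_isOpen_of_eq {f : X → Y} {U : Set X} (hU : IsOpen U)
    (hf : ContinuousOn f U) (c : Y) (hc : ∀ x, x ∉ U → f x = c) : Measurable f := by
  refine measurable_of_isOpen fun V hV => ?_
  have hsplit : f ⁻¹' V = (U ∩ f ⁻¹' V) ∪ (Uᶜ ∩ f ⁻¹' V) := by
    rw [← Set.union_inter_distrib_right, Set.union_compl_self, Set.univ_inter]
  rw [hsplit]
  refine (hf.isOpen_inter_preimage hU hV).measurableSet.union ?_
  by_cases hcV : c ∈ V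
  · have : Uᶜ ∩ f ⁻¹' V = Uᶜ := by
      refine Set.inter_eq_left.2 fun x hx => ?_
      rw [Set.mem_preimage, hc x hx]; exact hcV
    rw [this]; exact hU.measurableSet.compl
  · have : Uᶜ ∩ f ⁻¹' V = ∅ := by
      refine Set.eq_empty_iff_forall_notMem.2 fun x hx => hcV ?_
      have h1 : f x = c := hc x hx.1
      rw [← h1]; exact hx.2
    rw [this]; exact MeasurableSet.empty

end MeasTool

section Drift

variable {m : Type*} [Fintype m] [DecidableEq m]

omit [DecidableEq m] in
/-- The inner product of Euclidean vectors is the dot product of their coordinates. -/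
theorem inner_eq_dotProduct_ofLp (x y : (EuclideanSpace ℝ m)) : ⟪x, y⟫_ℝ = ofLp x ⬝ᵥ ofLp y := by
  rw [EuclideanSpace.inner_eq_star_dotProduct, star_trivial, dotProduct_comm]

omit [DecidableEq m] in
/-- The norm of `toLp 2 w` is `√(w·w)`. -/
theorem norm_toLp_eq_sqrt (w : m → ℝ) : ‖(toLp 2 w : (EuclideanSpace ℝ m))‖ = Real.sqrt (w ⬝ᵥ w) := by
  rw [← norm_toLp_sq, Real.sqrt_sq (norm_nonneg _)]

omit [DecidableEq m] in
/-- A point of the unit sphere has a unit coordinate vector. -/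
theorem sphere_dotProduct_self (e : (sphere (0 : EuclideanSpace ℝ m) 1)) : ofLp (e : (EuclideanSpace ℝ m)) ⬝ᵥ ofLp (e : (EuclideanSpace ℝ m)) = 1 := by
  rw [← inner_eq_dotProduct_ofLp, real_inner_self_eq_norm_sq, norm_eq_of_mem_sphere e, one_pow]

/-- The BODY-FRAME TANGENTIAL MOMENTUM: coordinates of `q` minus its component along the body axis `e`. -/
def bodyTangent (e : (sphere (0 : EuclideanSpace ℝ m) 1)) (q : (EuclideanSpace ℝ m)) : m → ℝ := ofLp q - (ofLp (e : (EuclideanSpace ℝ m)) ⬝ᵥ ofLp q) • ofLp (e : (EuclideanSpace ℝ m))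

omit [DecidableEq m] in
/-- It is orthogonal to the axis. -/
theorem bodyTangent_dotProduct_axis (e : (sphere (0 : EuclideanSpace ℝ m) 1)) (q : (EuclideanSpace ℝ m)) : bodyTangent e q ⬝ᵥ ofLp (e : (EuclideanSpace ℝ m)) = 0 := by
  rw [bodyTangent, sub_dotProduct, smul_dotProduct, sphere_dotProduct_self, smul_eq_mul, mul_one,
    dotProduct_comm, sub_self]

omit [DecidableEq m] in
/-- It depends continuously on `q`. -/
theorem continuous_bodyTangent (e : (sphere (0 : EuclideanSpace ℝ m) 1)) : Continuous (bodyTangent e) :=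
  (PiLp.continuous_ofLp 2 _).sub
    ((continuous_const.dotProduct (PiLp.continuous_ofLp 2 _)).smul continuous_const)

omit [DecidableEq m] in
/-- As a Euclidean vector it is `q − ⟪e, q⟫ e`. -/
theorem toLp_bodyTangent (e : (sphere (0 : EuclideanSpace ℝ m) 1)) (q : (EuclideanSpace ℝ m)) :
    (toLp 2 (bodyTangent e q) : (EuclideanSpace ℝ m)) = q - ⟪(e : (EuclideanSpace ℝ m)), q⟫_ℝ • (e : (EuclideanSpace ℝ m)) := by
  rw [bodyTangent, toLp_sub, toLp_smul, toLp_ofLp, toLp_ofLp, inner_eq_dotProduct_ofLp]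

/-- **The body rotation** `R_t(q) ∈ SO(d)`: rotates the axis `e` towards the body-frame tangential
momentum by the angle `‖q − ⟪e,q⟫e‖ t`. -/
def bodyRot (t : ℝ) (e : (sphere (0 : EuclideanSpace ℝ m) 1)) (q : (EuclideanSpace ℝ m)) : (Matrix.specialOrthogonalGroup m ℝ) :=
  ⟨planeRot t (ofLp (e : (EuclideanSpace ℝ m))) (bodyTangent e q),
    planeRot_mem_specialOrthogonalGroup t (sphere_dotProduct_self e) (bodyTangent_dotProduct_axis e q)⟩

/-- **`q ↦ R_t(q)` is measurable** (continuous off the axis line, `= 1` on it). -/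
theorem measurable_bodyRot (t : ℝ) (e : (sphere (0 : EuclideanSpace ℝ m) 1)) : Measurable (bodyRot t e) := by
  have hUo : IsOpen {q : (EuclideanSpace ℝ m) | bodyTangent e q ≠ 0} := isOpen_ne_fun (continuous_bodyTangent e) continuous_const
  have hmat : ContinuousOn (fun q : (EuclideanSpace ℝ m) => planeRot t (ofLp (e : (EuclideanSpace ℝ m))) (bodyTangent e q))
      {q : (EuclideanSpace ℝ m) | bodyTangent e q ≠ 0} :=
    (continuousOn_planeRot t (sphere_dotProduct_self e)).comp (continuous_bodyTangent e).continuousOn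
      (fun q hq => ⟨bodyTangent_dotProduct_axis e q, hq⟩)
  have hcont : ContinuousOn (bodyRot t e) {q : (EuclideanSpace ℝ m) | bodyTangent e q ≠ 0} := by
    rw [continuousOn_iff_continuous_restrict] at hmat ⊢
    exact hmat.subtype_mk _
  refine measurable_of_continuousOn_isOpen_of_eq hUo hcont 1 (fun q hq => ?_)
  have h0 : bodyTangent e q = 0 := by
    by_contra h; exact hq h
  apply Subtype.ext
  change planeRot t (ofLp (e : (EuclideanSpace ℝ m))) (bodyTangent e q) = 1
  rw [h0, planeRot_zero_right]

/-- The body rotation moves the axis: `R e = cos θ · e + (sin θ/ρ) · w`, `w = q − ⟪e,q⟫e`, `ρ = ‖w‖`,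
`θ = ρ t`. -/
theorem rotSO_bodyRot_axis (t : ℝ) (e : (sphere (0 : EuclideanSpace ℝ m) 1)) (q : (EuclideanSpace ℝ m)) :
    rotSO (bodyRot t e q) (e : (EuclideanSpace ℝ m)) =
      Real.cos (‖(toLp 2 (bodyTangent e q) : (EuclideanSpace ℝ m))‖ * t) • (e : (EuclideanSpace ℝ m)) +
        (Real.sin (‖(toLp 2 (bodyTangent e q) : (EuclideanSpace ℝ m))‖ * t) / ‖(toLp 2 (bodyTangent e q) : (EuclideanSpace ℝ m))‖) •
          (toLp 2 (bodyTangent e q) : (EuclideanSpace ℝ m)) := by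
  rw [rotSO_apply, norm_toLp_eq_sqrt]
  change toLp 2 (planeRot t (ofLp (e : (EuclideanSpace ℝ m))) (bodyTangent e q) *ᵥ ofLp (e : (EuclideanSpace ℝ m))) = _
  rw [planeRot_mulVec_axis t (sphere_dotProduct_self e) (bodyTangent_dotProduct_axis e q), toLp_add,
    toLp_smul, toLp_smul, toLp_ofLp]

/-- … and the tangential momentum: `R w = cos θ · w − (ρ sin θ) · e`. -/
theorem rotSO_bodyRot_tangent (t : ℝ) (e : (sphere (0 : EuclideanSpace ℝ m) 1)) (q : (EuclideanSpace ℝ m)) :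
    rotSO (bodyRot t e q) (toLp 2 (bodyTangent e q) : (EuclideanSpace ℝ m)) =
      Real.cos (‖(toLp 2 (bodyTangent e q) : (EuclideanSpace ℝ m))‖ * t) • (toLp 2 (bodyTangent e q) : (EuclideanSpace ℝ m)) -
        (‖(toLp 2 (bodyTangent e q) : (EuclideanSpace ℝ m))‖ * Real.sin (‖(toLp 2 (bodyTangent e q) : (EuclideanSpace ℝ m))‖ * t)) • (e : (EuclideanSpace ℝ m)) := by
  rw [rotSO_apply, norm_toLp_eq_sqrt, ofLp_toLp]
  change toLp 2 (planeRot t (ofLp (e : (EuclideanSpace ℝ m))) (bodyTangent e q) *ᵥ bodyTangent e q) = _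
  rw [planeRot_mulVec_tangent t (sphere_dotProduct_self e) (bodyTangent_dotProduct_axis e q), toLp_sub,
    toLp_smul, toLp_smul, toLp_ofLp]

/-- The tangential part of an ambient momentum at a point of the sphere. -/
def tangentialPart (z : (sphere (0 : EuclideanSpace ℝ m) 1) × (EuclideanSpace ℝ m)) : (EuclideanSpace ℝ m) := z.2 - ⟪(z.1 : (EuclideanSpace ℝ m)), z.2⟫_ℝ • (z.1 : (EuclideanSpace ℝ m))

omit [DecidableEq m] in
/-- It is tangent. -/
theorem inner_tangentialPart (z : (sphere (0 : EuclideanSpace ℝ m) 1) × (EuclideanSpace ℝ m)) : ⟪(z.1 : (EuclideanSpace ℝ m)), tangentialPart z⟫_ℝ = 0 := by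
  rw [tangentialPart, inner_sub_right, real_inner_smul_right, real_inner_self_eq_norm_sq,
    norm_eq_of_mem_sphere z.1, one_pow, mul_one, sub_self]

omit [DecidableEq m] in
/-- It is continuous. -/
theorem continuous_tangentialPart : Continuous (tangentialPart : (sphere (0 : EuclideanSpace ℝ m) 1) × (EuclideanSpace ℝ m) → (EuclideanSpace ℝ m)) := by
  have h1 : Continuous fun z : (sphere (0 : EuclideanSpace ℝ m) 1) × (EuclideanSpace ℝ m) => (z.1 : (EuclideanSpace ℝ m)) := continuous_subtype_val.comp continuous_fst
  have h2 : Continuous fun z : (sphere (0 : EuclideanSpace ℝ m) 1) × (EuclideanSpace ℝ m) => ⟪(z.1 : (EuclideanSpace ℝ m)), z.2⟫_ℝ := h1.inner continuous_snd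
  exact continuous_snd.sub (h2.smul h1)

/-- **The geodesic drift with ambient momenta** (E–S eq. (11) applied to the tangential part, the
normal component `⟪x, p⟫` carried along): `(x, p) ↦ (x', π' + ⟪x, p⟫ x')` where
`(x', π') = geodesicDrift t (x, p − ⟪x,p⟫ x)`. -/
def ambientDrift (t : ℝ) (z : (sphere (0 : EuclideanSpace ℝ m) 1) × (EuclideanSpace ℝ m)) : (sphere (0 : EuclideanSpace ℝ m) 1) × (EuclideanSpace ℝ m) :=
  (⟨(geodesicDrift t ((z.1 : (EuclideanSpace ℝ m)), tangentialPart z)).1, by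
      rw [mem_sphere_zero_iff_norm]
      exact norm_fst_geodesicDrift t (norm_eq_of_mem_sphere z.1) (inner_tangentialPart z)⟩,
    (geodesicDrift t ((z.1 : (EuclideanSpace ℝ m)), tangentialPart z)).2 +
      ⟪(z.1 : (EuclideanSpace ℝ m)), z.2⟫_ℝ • (geodesicDrift t ((z.1 : (EuclideanSpace ℝ m)), tangentialPart z)).1)

omit [DecidableEq m] in
/-- The drift formula of E–S eq. (11) is measurable on `E × E`. -/
theorem measurable_geodesicDrift (t : ℝ) : Measurable (geodesicDrift t : (EuclideanSpace ℝ m) × (EuclideanSpace ℝ m) → (EuclideanSpace ℝ m) × (EuclideanSpace ℝ m)) := by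
  have hn : Measurable fun z : (EuclideanSpace ℝ m) × (EuclideanSpace ℝ m) => ‖z.2‖ := measurable_snd.norm
  have hc : Measurable fun z : (EuclideanSpace ℝ m) × (EuclideanSpace ℝ m) => Real.cos (‖z.2‖ * t) :=
    Real.measurable_cos.comp (hn.mul_const t)
  have hs : Measurable fun z : (EuclideanSpace ℝ m) × (EuclideanSpace ℝ m) => Real.sin (‖z.2‖ * t) :=
    Real.measurable_sin.comp (hn.mul_const t)
  unfold geodesicDrift
  exact ((hc.smul measurable_fst).add ((hs.div hn).smul measurable_snd)).prodMk
    (((hn.mul hs).neg.smul measurable_fst).add (hc.smul measurable_snd))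

omit [DecidableEq m] in
/-- The ambient drift is measurable. -/
theorem measurable_ambientDrift (t : ℝ) : Measurable (ambientDrift t : (sphere (0 : EuclideanSpace ℝ m) 1) × (EuclideanSpace ℝ m) → (sphere (0 : EuclideanSpace ℝ m) 1) × (EuclideanSpace ℝ m)) := by
  have hxv : Measurable fun z : (sphere (0 : EuclideanSpace ℝ m) 1) × (EuclideanSpace ℝ m) => ((z.1 : (EuclideanSpace ℝ m)), tangentialPart z) :=
    (measurable_subtype_coe.comp measurable_fst).prodMk continuous_tangentialPart.measurable
  have hg : Measurable fun z : (sphere (0 : EuclideanSpace ℝ m) 1) × (EuclideanSpace ℝ m) => geodesicDrift t ((z.1 : (EuclideanSpace ℝ m)), tangentialPart z) :=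
    (measurable_geodesicDrift t).comp hxv
  have hi : Measurable fun z : (sphere (0 : EuclideanSpace ℝ m) 1) × (EuclideanSpace ℝ m) => ⟪(z.1 : (EuclideanSpace ℝ m)), z.2⟫_ℝ :=
    ((continuous_subtype_val.comp continuous_fst).inner continuous_snd).measurable
  exact (measurable_fst.comp hg).subtype_mk.prodMk
    ((measurable_snd.comp hg).add (hi.smul (measurable_fst.comp hg)))

/-- **The lift of the drift**: rotate the frame by the body rotation, keep the body-frame momentum. -/
def driftLift (t : ℝ) (e : (sphere (0 : EuclideanSpace ℝ m) 1)) (p : (Matrix.specialOrthogonalGroup m ℝ) × (EuclideanSpace ℝ m)) : (Matrix.specialOrthogonalGroup m ℝ) × (EuclideanSpace ℝ m) := (p.1 * bodyRot t e p.2, p.2)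

/-- **The lift preserves `Haar ⊗ Lebesgue`** — right invariance of Haar on the compact group
`SO(d)`, fibre by fibre over the body-frame momentum. -/
theorem measurePreserving_driftLift (t : ℝ) (e : (sphere (0 : EuclideanSpace ℝ m) 1)) :
    MeasurePreserving (driftLift t e) (((Literature.MathematicalPhysics.QuantumFieldTheory.haarProbability (Matrix.specialOrthogonalGroup m ℝ))).prod (volume : Measure (EuclideanSpace ℝ m)))
      (((Literature.MathematicalPhysics.QuantumFieldTheory.haarProbability (Matrix.specialOrthogonalGroup m ℝ))).prod (volume : Measure (EuclideanSpace ℝ m))) := by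
  haveI : SecondCountableTopology (Matrix m m ℝ) :=
    inferInstanceAs (SecondCountableTopology (m → m → ℝ))
  haveI : SecondCountableTopology (Matrix.specialOrthogonalGroup m ℝ) := TopologicalSpace.secondCountableTopology_induced (Matrix.specialOrthogonalGroup m ℝ) (Matrix m m ℝ) Subtype.val
  haveI : MeasurableMul₂ (Matrix.specialOrthogonalGroup m ℝ) := ContinuousMul.measurableMul₂
  have hgm : Measurable (Function.uncurry fun (q : (EuclideanSpace ℝ m)) (O : (Matrix.specialOrthogonalGroup m ℝ)) => O * bodyRot t e q) :=
    measurable_snd.mul ((measurable_bodyRot t e).comp measurable_fst)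
  exact MeasurePreserving.skew_product_snd (g := fun (q : (EuclideanSpace ℝ m)) (O : (Matrix.specialOrthogonalGroup m ℝ)) => O * bodyRot t e q) hgm
    (fun q => (measurePreserving_mul_right (Literature.MathematicalPhysics.QuantumFieldTheory.haarProbability (Matrix.specialOrthogonalGroup m ℝ)) (bodyRot t e q)).map_eq)

/-- **The lift identity**: `frameMap ∘ driftLift = ambientDrift ∘ frameMap`. -/
theorem frameMap_driftLift (t : ℝ) (e : (sphere (0 : EuclideanSpace ℝ m) 1)) (p : (Matrix.specialOrthogonalGroup m ℝ) × (EuclideanSpace ℝ m)) :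
    frameMap e (driftLift t e p) = ambientDrift t (frameMap e p) := by
  obtain ⟨O, q⟩ := p
  -- the data seen from the phase-space side
  have hx : ((actSO O e : (sphere (0 : EuclideanSpace ℝ m) 1)) : (EuclideanSpace ℝ m)) = rotSO O (e : (EuclideanSpace ℝ m)) := coe_actSO_eq_rotSO O e
  have hip : ⟪((actSO O e : (sphere (0 : EuclideanSpace ℝ m) 1)) : (EuclideanSpace ℝ m)), rotSO O q⟫_ℝ = ⟪(e : (EuclideanSpace ℝ m)), q⟫_ℝ := by
    rw [hx, LinearIsometryEquiv.inner_map_map]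
  have hv : tangentialPart (actSO O e, rotSO O q) = rotSO O (toLp 2 (bodyTangent e q)) := by
    simp only [tangentialPart]
    rw [hip, hx, toLp_bodyTangent, map_sub, map_smul]
  have hnv : ‖tangentialPart (actSO O e, rotSO O q)‖ = ‖(toLp 2 (bodyTangent e q) : (EuclideanSpace ℝ m))‖ := by
    rw [hv, LinearIsometryEquiv.norm_map]
  have hq : q = (toLp 2 (bodyTangent e q) : (EuclideanSpace ℝ m)) + ⟪(e : (EuclideanSpace ℝ m)), q⟫_ℝ • (e : (EuclideanSpace ℝ m)) := by
    rw [toLp_bodyTangent, sub_add_cancel]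
  simp only [frameMap, driftLift, ambientDrift]
  refine Prod.ext (Subtype.ext ?_) ?_
  · -- positions
    change ((actSO (O * bodyRot t e q) e : (sphere (0 : EuclideanSpace ℝ m) 1)) : (EuclideanSpace ℝ m)) = (geodesicDrift t _).1
    rw [coe_actSO_eq_rotSO, rotSO_mul, rotSO_bodyRot_axis]
    simp only [map_add, map_smul, geodesicDrift]
    rw [hnv, hv, hx]
  · -- momenta
    change rotSO (O * bodyRot t e q) q = (geodesicDrift t _).2 + _ • (geodesicDrift t _).1
    rw [rotSO_mul, hip]
    have hq' : rotSO (bodyRot t e q) q =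
        rotSO (bodyRot t e q) ((toLp 2 (bodyTangent e q) : (EuclideanSpace ℝ m)) + ⟪(e : (EuclideanSpace ℝ m)), q⟫_ℝ • (e : (EuclideanSpace ℝ m))) := by
      rw [← hq]
    rw [hq', map_add, map_smul, rotSO_bodyRot_tangent, rotSO_bodyRot_axis]
    simp only [map_add, map_sub, map_smul, geodesicDrift]
    rw [hnv, hv, hx]
    module

/-! ### Tangential/normal bookkeeping and time reversal of the ambient drift -/

omit [DecidableEq m] in
/-- An ambient momentum splits orthogonally: `‖p‖² = ‖p − ⟪x,p⟫x‖² + ⟪x,p⟫²`. -/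
theorem norm_sq_eq_tangential_add_normal (z : (sphere (0 : EuclideanSpace ℝ m) 1) × (EuclideanSpace ℝ m)) :
    ‖z.2‖ ^ 2 = ‖tangentialPart z‖ ^ 2 + ⟪(z.1 : (EuclideanSpace ℝ m)), z.2⟫_ℝ ^ 2 := by
  have hx : ‖(z.1 : (EuclideanSpace ℝ m))‖ = 1 := norm_eq_of_mem_sphere z.1
  have h : z.2 = tangentialPart z + ⟪(z.1 : (EuclideanSpace ℝ m)), z.2⟫_ℝ • (z.1 : (EuclideanSpace ℝ m)) := by
    rw [tangentialPart, sub_add_cancel]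
  have horth : ⟪tangentialPart z, ⟪(z.1 : (EuclideanSpace ℝ m)), z.2⟫_ℝ • (z.1 : (EuclideanSpace ℝ m))⟫_ℝ = 0 := by
    rw [real_inner_smul_right, real_inner_comm (z.1 : (EuclideanSpace ℝ m)) (tangentialPart z), inner_tangentialPart,
      mul_zero]
  conv_lhs => rw [h]
  rw [norm_add_sq_real, horth, mul_zero, add_zero, norm_smul, hx, mul_one, Real.norm_eq_abs, sq_abs]

omit [DecidableEq m] in
/-- **The normal component is carried by the drift**: `⟪x', p'⟫ = ⟪x, p⟫`. -/
theorem inner_ambientDrift (t : ℝ) (z : (sphere (0 : EuclideanSpace ℝ m) 1) × (EuclideanSpace ℝ m)) :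
    ⟪((ambientDrift t z).1 : (EuclideanSpace ℝ m)), (ambientDrift t z).2⟫_ℝ = ⟪(z.1 : (EuclideanSpace ℝ m)), z.2⟫_ℝ := by
  have hx : ‖(z.1 : (EuclideanSpace ℝ m))‖ = 1 := norm_eq_of_mem_sphere z.1
  have hv := inner_tangentialPart z
  have h1 := norm_fst_geodesicDrift t hx hv
  have h12 := inner_geodesicDrift t hx hv
  change ⟪(geodesicDrift t ((z.1 : (EuclideanSpace ℝ m)), tangentialPart z)).1,
    (geodesicDrift t ((z.1 : (EuclideanSpace ℝ m)), tangentialPart z)).2 + ⟪(z.1 : (EuclideanSpace ℝ m)), z.2⟫_ℝ •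
      (geodesicDrift t ((z.1 : (EuclideanSpace ℝ m)), tangentialPart z)).1⟫_ℝ = _
  rw [inner_add_right, h12, real_inner_smul_right, real_inner_self_eq_norm_sq, h1, one_pow, mul_one,
    zero_add]

omit [DecidableEq m] in
/-- **The tangential momentum follows E–S eq. (11)**: `p' − ⟪x',p'⟫x' = π(t)`. -/
theorem tangentialPart_ambientDrift (t : ℝ) (z : (sphere (0 : EuclideanSpace ℝ m) 1) × (EuclideanSpace ℝ m)) :
    tangentialPart (ambientDrift t z) = (geodesicDrift t ((z.1 : (EuclideanSpace ℝ m)), tangentialPart z)).2 := by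
  rw [tangentialPart, inner_ambientDrift]
  change (geodesicDrift t ((z.1 : (EuclideanSpace ℝ m)), tangentialPart z)).2 + ⟪(z.1 : (EuclideanSpace ℝ m)), z.2⟫_ℝ •
      (geodesicDrift t ((z.1 : (EuclideanSpace ℝ m)), tangentialPart z)).1 -
    ⟪(z.1 : (EuclideanSpace ℝ m)), z.2⟫_ℝ • (geodesicDrift t ((z.1 : (EuclideanSpace ℝ m)), tangentialPart z)).1 = _
  rw [add_sub_cancel_right]

omit [DecidableEq m] in
/-- For a force field TANGENT on the sphere the kick does not touch the normal component. -/
theorem inner_ambientKick {F : (EuclideanSpace ℝ m) → (EuclideanSpace ℝ m)} (hF : ∀ x : (sphere (0 : EuclideanSpace ℝ m) 1), ⟪(x : (EuclideanSpace ℝ m)), F x⟫_ℝ = 0) (δ : ℝ) (z : (sphere (0 : EuclideanSpace ℝ m) 1) × (EuclideanSpace ℝ m)) :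
    ⟪((ambientKick F δ z).1 : (EuclideanSpace ℝ m)), (ambientKick F δ z).2⟫_ℝ = ⟪(z.1 : (EuclideanSpace ℝ m)), z.2⟫_ℝ := by
  change ⟪(z.1 : (EuclideanSpace ℝ m)), z.2 + δ • F z.1⟫_ℝ = _
  rw [inner_add_right, real_inner_smul_right, hF, mul_zero, add_zero]

omit [DecidableEq m] in
/-- **Time reversal for the ambient drift**: drift, flip, drift again = the flipped start. -/
theorem ambientDrift_flip_ambientDrift (t : ℝ) (z : (sphere (0 : EuclideanSpace ℝ m) 1) × (EuclideanSpace ℝ m)) :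
    ambientDrift t (ambientFlip (ambientDrift t z)) = ambientFlip z := by
  have hx : ‖(z.1 : (EuclideanSpace ℝ m))‖ = 1 := norm_eq_of_mem_sphere z.1
  have hv := inner_tangentialPart z
  -- the flipped intermediate state, seen through its tangential/normal split
  have hX : (((ambientFlip (ambientDrift t z)).1 : (sphere (0 : EuclideanSpace ℝ m) 1)) : (EuclideanSpace ℝ m)) =
      (geodesicDrift t ((z.1 : (EuclideanSpace ℝ m)), tangentialPart z)).1 := rfl
  have hT : tangentialPart (ambientFlip (ambientDrift t z)) =
      -(geodesicDrift t ((z.1 : (EuclideanSpace ℝ m)), tangentialPart z)).2 := by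
    have h := tangentialPart_ambientDrift t z
    simp only [tangentialPart, ambientFlip, inner_neg_right, neg_smul, sub_neg_eq_add] at h ⊢
    rw [← h]; abel
  have hN : ⟪(((ambientFlip (ambientDrift t z)).1 : (sphere (0 : EuclideanSpace ℝ m) 1)) : (EuclideanSpace ℝ m)), (ambientFlip (ambientDrift t z)).2⟫_ℝ =
      -⟪(z.1 : (EuclideanSpace ℝ m)), z.2⟫_ℝ := by
    simp only [ambientFlip, inner_neg_right, inner_ambientDrift]
  have key : geodesicDrift t ((geodesicDrift t ((z.1 : (EuclideanSpace ℝ m)), tangentialPart z)).1,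
      -(geodesicDrift t ((z.1 : (EuclideanSpace ℝ m)), tangentialPart z)).2) = ((z.1 : (EuclideanSpace ℝ m)), -tangentialPart z) := by
    have h := geodesicDrift_flip_geodesicDrift t hx hv
    simpa only [sphereMomFlip] using h
  -- assemble
  have hpair : geodesicDrift t ((((ambientFlip (ambientDrift t z)).1 : (sphere (0 : EuclideanSpace ℝ m) 1)) : (EuclideanSpace ℝ m)),
      tangentialPart (ambientFlip (ambientDrift t z))) = ((z.1 : (EuclideanSpace ℝ m)), -tangentialPart z) := by
    rw [hT, hX, key]
  refine Prod.ext (Subtype.ext ?_) ?_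
  · change (geodesicDrift t ((((ambientFlip (ambientDrift t z)).1 : (sphere (0 : EuclideanSpace ℝ m) 1)) : (EuclideanSpace ℝ m)),
      tangentialPart (ambientFlip (ambientDrift t z)))).1 = (z.1 : (EuclideanSpace ℝ m))
    rw [hpair]
  · change (geodesicDrift t ((((ambientFlip (ambientDrift t z)).1 : (sphere (0 : EuclideanSpace ℝ m) 1)) : (EuclideanSpace ℝ m)),
      tangentialPart (ambientFlip (ambientDrift t z)))).2 +
      ⟪(((ambientFlip (ambientDrift t z)).1 : (sphere (0 : EuclideanSpace ℝ m) 1)) : (EuclideanSpace ℝ m)), (ambientFlip (ambientDrift t z)).2⟫_ℝ •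
        (geodesicDrift t ((((ambientFlip (ambientDrift t z)).1 : (sphere (0 : EuclideanSpace ℝ m) 1)) : (EuclideanSpace ℝ m)),
          tangentialPart (ambientFlip (ambientDrift t z)))).1 = -z.2
    rw [hpair, hN]
    change -tangentialPart z + (-⟪(z.1 : (EuclideanSpace ℝ m)), z.2⟫_ℝ) • (z.1 : (EuclideanSpace ℝ m)) = -z.2
    rw [tangentialPart, neg_smul, ← neg_add, sub_add_cancel]

variable [Nonempty m]

/-- **Liouville for the geodesic drift, product form.**  The E–S geodesic drift with ambient momenta
preserves `uniformSphere ⊗ Lebesgue` on `S^{d−1} × ℝ^d` (`d = card m ≥ 2`): it is the shadow under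
the frame map of a Haar-preserving right translation. -/
theorem measurePreserving_ambientDrift (h2 : 2 ≤ Fintype.card m) (t : ℝ) (e : (sphere (0 : EuclideanSpace ℝ m) 1)) :
    MeasurePreserving (ambientDrift t : (sphere (0 : EuclideanSpace ℝ m) 1) × (EuclideanSpace ℝ m) → (sphere (0 : EuclideanSpace ℝ m) 1) × (EuclideanSpace ℝ m))
      ((uniformSphere (volume : Measure (EuclideanSpace ℝ m))).prod (volume : Measure (EuclideanSpace ℝ m)))
      ((uniformSphere (volume : Measure (EuclideanSpace ℝ m))).prod (volume : Measure (EuclideanSpace ℝ m))) :=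
  (measurePreserving_frameMap h2 e).of_semiconj (measurePreserving_driftLift t e)
    (frameMap_driftLift t e) (measurable_ambientDrift t)

end Drift

end Summit.Ventures.LatticeQCDFlow.Exactness

end
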